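import Mathlib
import HarnessLib
import HarnessLib.Audit
import Summits.ValiantsHypothesis.ValiantsHypothesis.Theorems.LacunarySymmetroidMatrixDescartesMiddleBinomial
import Summits.ValiantsHypothesis.ValiantsHypothesis.Theorems.LacunarySymmetroidMatrixDescartesDipWindow

/-!
# ValiantsHypothesis / LacunarySymmetroid — crux `MatrixDescartes` (stmt-ValiantsHypothesis-18050, V1), LINE (A) «product_plus_one»:
# the MULTIPLIER-QUOTIENT ENGINE for «one W row × zero-change block» cells (pen val-idea-25 g9 NOTE §56.11–§56.13 method, made generic)

Setting of the pen's Sketch-T3-s59 (`ZeroChange.row`, `ZeroChange.posCrit`): one W row `g = −α + κX^a + γX^c` (`α, γ > 0 ≤ κ`,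
`0 < a < c`) times a block `B = ∏_i P_i` of zero-change rows `P_i = p_i + q_iX^a + s_iX^c` with `p_i, q_i, s_i ≥ 0`, not all zero
(constant-free rows and monomial rows allowed).  With `θ = t·d/dt`, `N_i = θP_i = a q_i t^a + c s_i t^c`, `M_i = θN_i`, row rates
`ψ_i = N_i/P_i`, row variances `M_i/P_i − ψ_i²`, `ψ_B = Σψ_i`, `V = Σ(M_i/P_i − ψ_i²)`, `G = θg = aκt^a + cγt^c`, `G₂ = θG`, the
MULTIPLIER QUOTIENT `F̂ = (1 + g·ψ_B/G)/B` vanishes exactly at the positive critical points of `Φ = g·B` (`t·Φ′ = B·(G + g·ψ_B)`), and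
`F̂′ = (g·ψ_B/(t·B·G))·J` with the RATE FUNCTION

  `J(t) = V(t)/ψ_B(t) − ψ_B(t) − G₂(t)/G(t)`.

* ★ `exists_rateJ_zero_between_crit` — between two positive critical points of `Φ` the rate function `J` vanishes (Rolle on `F̂`;
  at critical points `g < 0 < ψ_B`, so the prefactor does not vanish in between);
* `posCrit_le_one_of_rateJ_ne_zero` — if `J` has no zero on `(0,∞)`, `Φ` has at most ONE positive critical point;
* `posCrit_le_two_of_rateJ_zero_once` — if `J` vanishes at most once on `(0,∞)`, at most TWO.

So a cell of this family is reduced to an inequality about ONE explicit function of `t` (no derivative bookkeeping left): the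
tree cells ✓ `topBinomialBlockAtMostTwo` (`J` strictly decreasing) and ✓ `constantFreeRowAtMostOne` (`J < 0` by Bhatia–Davis) are
instances; the pen's Theorem D (`c ≤ 2a` ⇒ `≤ 2`) and T3♯ are statements about the zeros of this same `J`.

HONEST FRAMING: engine/helper for free-standing cells of the floor `OneChangeFloorK3` (one `(+,−,−)`-type row with one-signed rows,
bottom coupling); closes NO stub; `OneChangeFloorK3`, `MatrixDescartes` OPEN; `VP ≠ VNP` is NOT proved and nothing here bears on it.
No definitions, no named facts, no sorry.
-/

set_option linter.dupNamespace false

namespace Summit.ValiantsHypothesis.ValiantsHypothesis.Theorems.LacunarySymmetroidMatrixDescartes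

namespace ZeroChange

open Polynomial Finset Set

/-- ★ **ENGINE (Rolle on the multiplier quotient).**  One W row `(−α, κ, γ)` (`κ ≥ 0 < γ`, `α` arbitrary) times a block of zero-change rows
`(p_i, q_i, s_i)` (all `≥ 0`, each row nonzero): strictly between two positive critical points `u < v` of the product, the rate function
`J = V/ψ_B − ψ_B − G₂/G` (written out below) has a zero. -/
theorem exists_rateJ_zero_between_crit (k a c : ℕ) (ha : 0 < a) (hac : a < c) (α κ γ : ℝ) (p q s : Fin k → ℝ)
    (hκ : 0 ≤ κ) (hγ : 0 < γ) (h : ∀ i, 0 ≤ p i ∧ 0 ≤ q i ∧ 0 ≤ s i ∧ 0 < p i + q i + s i)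
    {u v : ℝ} (hu : 0 < u) (huv : u < v)
    (hDu : (derivative (row a c (-α) κ γ * ∏ i, row a c (p i) (q i) (s i))).eval u = 0)
    (hDv : (derivative (row a c (-α) κ γ * ∏ i, row a c (p i) (q i) (s i))).eval v = 0) :
    ∃ ξ, u < ξ ∧ ξ < v ∧
      (∑ i, (((a : ℝ) ^ 2 * q i * ξ ^ a + (c : ℝ) ^ 2 * s i * ξ ^ c) / (p i + q i * ξ ^ a + s i * ξ ^ c)
          - (((a : ℝ) * q i * ξ ^ a + (c : ℝ) * s i * ξ ^ c) / (p i + q i * ξ ^ a + s i * ξ ^ c)) ^ 2)) /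
        (∑ i, ((a : ℝ) * q i * ξ ^ a + (c : ℝ) * s i * ξ ^ c) / (p i + q i * ξ ^ a + s i * ξ ^ c))
      - (∑ i, ((a : ℝ) * q i * ξ ^ a + (c : ℝ) * s i * ξ ^ c) / (p i + q i * ξ ^ a + s i * ξ ^ c))
      - ((a : ℝ) ^ 2 * κ * ξ ^ a + (c : ℝ) ^ 2 * γ * ξ ^ c) / ((a : ℝ) * κ * ξ ^ a + (c : ℝ) * γ * ξ ^ c) = 0 := by
  classical
  have hc : 0 < c := ha.trans hac
  have ha' : (0 : ℝ) < a := by exact_mod_cast ha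
  have hc' : (0 : ℝ) < c := by exact_mod_cast hc
  -- the polynomial objects
  set gW : ℝ[X] := row a c (-α) κ γ with hgW
  set B : ℝ[X] := ∏ i, row a c (p i) (q i) (s i) with hB
  -- the real functions of the proof
  obtain ⟨P, hP⟩ : ∃ P : Fin k → ℝ → ℝ, ∀ i t, P i t = p i + q i * t ^ a + s i * t ^ c := ⟨_, fun _ _ => rfl⟩
  obtain ⟨N, hN⟩ : ∃ N : Fin k → ℝ → ℝ, ∀ i t, N i t = (a : ℝ) * q i * t ^ a + (c : ℝ) * s i * t ^ c :=
    ⟨_, fun _ _ => rfl⟩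
  obtain ⟨M, hM⟩ : ∃ M : Fin k → ℝ → ℝ, ∀ i t, M i t = (a : ℝ) ^ 2 * q i * t ^ a + (c : ℝ) ^ 2 * s i * t ^ c :=
    ⟨_, fun _ _ => rfl⟩
  obtain ⟨ψ, hψ⟩ : ∃ ψ : Fin k → ℝ → ℝ, ∀ i t, ψ i t = N i t / P i t := ⟨_, fun _ _ => rfl⟩
  obtain ⟨ψB, hψB⟩ : ∃ ψB : ℝ → ℝ, ∀ t, ψB t = ∑ i, ψ i t := ⟨_, fun _ => rfl⟩
  obtain ⟨V, hV⟩ : ∃ V : ℝ → ℝ, ∀ t, V t = ∑ i, (M i t / P i t - ψ i t ^ 2) := ⟨_, fun _ => rfl⟩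
  obtain ⟨g, hg⟩ : ∃ g : ℝ → ℝ, ∀ t, g t = -α + κ * t ^ a + γ * t ^ c := ⟨_, fun _ => rfl⟩
  obtain ⟨G, hG⟩ : ∃ G : ℝ → ℝ, ∀ t, G t = (a : ℝ) * κ * t ^ a + (c : ℝ) * γ * t ^ c := ⟨_, fun _ => rfl⟩
  obtain ⟨G₂, hG₂⟩ : ∃ G₂ : ℝ → ℝ, ∀ t, G₂ t = (a : ℝ) ^ 2 * κ * t ^ a + (c : ℝ) ^ 2 * γ * t ^ c :=
    ⟨_, fun _ => rfl⟩
  obtain ⟨Bf, hBf⟩ : ∃ Bf : ℝ → ℝ, ∀ t, Bf t = ∏ i, P i t := ⟨_, fun _ => rfl⟩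
  obtain ⟨J, hJ⟩ : ∃ J : ℝ → ℝ, ∀ t, J t = V t / ψB t - ψB t - G₂ t / G t := ⟨_, fun _ => rfl⟩
  obtain ⟨F, hF⟩ : ∃ F : ℝ → ℝ, ∀ t, F t = (1 + g t * ψB t / G t) / Bf t := ⟨_, fun _ => rfl⟩
  -- restate the goal through `J`
  suffices hgoal : ∃ ξ, u < ξ ∧ ξ < v ∧ J ξ = 0 by
    obtain ⟨ξ, h1, h2, h3⟩ := hgoal
    refine ⟨ξ, h1, h2, ?_⟩
    rw [hJ, hV, hψB, hG₂, hG] at h3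
    simp only [hψ, hM, hN, hP] at h3
    exact h3
  -- elementary facts
  have hPpos : ∀ i t, 0 < t → 0 < P i t := fun i t ht => by
    rw [hP]
    obtain ⟨hp, hq, hs, hsum⟩ := h i
    have h1 : 0 ≤ q i * t ^ a := mul_nonneg hq (pow_pos ht a).le
    have h2 : 0 ≤ s i * t ^ c := mul_nonneg hs (pow_pos ht c).le
    rcases hp.eq_or_lt with h0 | h0
    · rcases hq.eq_or_lt with h0' | h0'
      · have : 0 < s i := by linarith
        have : 0 < s i * t ^ c := mul_pos this (pow_pos ht c)
        linarith
      · have : 0 < q i * t ^ a := mul_pos h0' (pow_pos ht a)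
        linarith
    · linarith
  have hProw : ∀ i t, (row a c (p i) (q i) (s i)).eval t = P i t := fun i t => by simp [eval_row, hP]
  have hgrow : ∀ t, gW.eval t = g t := fun t => by simp [hgW, eval_row, hg]
  have hBev : ∀ t, B.eval t = Bf t := fun t => by
    rw [hB, eval_prod, hBf]; exact prod_congr rfl fun i _ => hProw i t
  have hBpos : ∀ t, 0 < t → 0 < Bf t := fun t ht => by
    rw [hBf]; exact prod_pos fun i _ => hPpos i t ht
  have hGpos : ∀ t, 0 < t → 0 < G t := fun t ht => by
    rw [hG]; exact add_pos_of_nonneg_of_pos (by positivity) (by positivity)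
  have hNnn : ∀ i t, 0 < t → 0 ≤ N i t := fun i t ht => by
    rw [hN]
    exact add_nonneg (mul_nonneg (mul_nonneg ha'.le (h i).2.1) (pow_pos ht a).le)
      (mul_nonneg (mul_nonneg hc'.le (h i).2.2.1) (pow_pos ht c).le)
  have hψnn : ∀ i t, 0 < t → 0 ≤ ψ i t := fun i t ht => by
    rw [hψ]; exact div_nonneg (hNnn i t ht) (hPpos i t ht).le
  have hψBnn : ∀ t, 0 < t → 0 ≤ ψB t := fun t ht => by
    rw [hψB]; exact sum_nonneg fun i _ => hψnn i t ht
  have hgmono : ∀ t t', 0 ≤ t → t ≤ t' → g t ≤ g t' := fun t t' ht htt => by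
    rw [← hgrow, ← hgrow, hgW]; exact eval_row_mono _ hκ hγ.le ht htt
  -- `t·B′(t) = B(t)·ψ_B(t)` and `t·g′(t) = G(t)`
  have hBder : ∀ t, 0 < t → (derivative B).eval t = Bf t * (ψB t / t) := by
    intro t ht
    have hprodder : (derivative (∏ i, row a c (p i) (q i) (s i))).eval t =
        (∏ i, row a c (p i) (q i) (s i)).eval t *
          ∑ i, (derivative (row a c (p i) (q i) (s i))).eval t / (row a c (p i) (q i) (s i)).eval t := by
      have := eval_derivative_prod_rows k a c (fun i => (p i, q i, s i)) (x := t)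
        (fun j => by simpa [hProw] using (hPpos j t ht).ne')
      simpa using this
    have hsum : t * ∑ i, (derivative (row a c (p i) (q i) (s i))).eval t / (row a c (p i) (q i) (s i)).eval t
        = ∑ i, ψ i t := by
      rw [mul_sum]
      refine sum_congr rfl fun i _ => ?_
      rw [mul_div_assoc', mul_eval_derivative_row, hProw, hψ, hN]
    rw [mul_div_assoc', eq_div_iff ht.ne', hB, hprodder, ← hB, hBev, hψB, ← hsum]
    ring
  have hgWder : ∀ t, t * (derivative gW).eval t = G t := fun t => by
    rw [hgW, mul_eval_derivative_row, hG]
  -- the link `t·Φ′(t) = B(t)·(G(t) + g(t)·ψ_B(t))`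
  have hlink : ∀ t, 0 < t →
      t * (derivative (gW * B)).eval t = Bf t * (G t + g t * ψB t) := by
    intro t ht
    rw [derivative_mul, eval_add,
      show (derivative gW * B).eval t = (derivative gW).eval t * B.eval t from eval_mul,
      show (gW * derivative B).eval t = gW.eval t * (derivative B).eval t from eval_mul, hBder t ht, hgrow, hBev]
    calc t * ((derivative gW).eval t * Bf t + g t * (Bf t * (ψB t / t)))
        = (t * (derivative gW).eval t) * Bf t + g t * Bf t * ψB t * (t / t) := by ring
      _ = Bf t * (G t + g t * ψB t) := by rw [hgWder, div_self ht.ne']; ring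
  -- at a positive critical point: `G + g·ψ_B = 0`, hence `g < 0 < ψ_B` and `F = 0`
  have hcrit : ∀ t, 0 < t → (derivative (gW * B)).eval t = 0 → g t < 0 ∧ 0 < ψB t ∧ F t = 0 := by
    intro t ht hD
    have h0 : G t + g t * ψB t = 0 := by
      have := hlink t ht
      rw [hD, mul_zero] at this
      rcases mul_eq_zero.1 this.symm with h1 | h1
      · exact absurd h1 (hBpos t ht).ne'
      · exact h1
    have hgS : g t * ψB t < 0 := by linarith [hGpos t ht]
    have hS : 0 < ψB t := by
      rcases (hψBnn t ht).eq_or_lt with h1 | h1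
      · rw [← h1, mul_zero] at hgS; exact absurd hgS (lt_irrefl _)
      · exact h1
    have hgt : g t < 0 := by
      rcases lt_or_ge (g t) 0 with h1 | h1
      · exact h1
      · nlinarith [mul_nonneg h1 hS.le]
    refine ⟨hgt, hS, ?_⟩
    have e : g t * ψB t = -G t := by linarith
    rw [hF, e, neg_div, div_self (hGpos t ht).ne', add_neg_cancel, zero_div]
  -- `ψ_B > 0` everywhere, from one critical point
  have hψBpos : ∀ t, 0 < t → 0 < ψB t := by
    obtain ⟨-, hSv, -⟩ := hcrit v (hu.trans huv) hDv
    have hv : 0 < v := hu.trans huv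
    obtain ⟨i, -, hi⟩ : ∃ i ∈ (univ : Finset (Fin k)), 0 < ψ i v := by
      by_contra hne
      push Not at hne
      have : ψB v ≤ 0 := by rw [hψB]; exact sum_nonpos hne
      linarith
    have hqs : 0 < q i ∨ 0 < s i := by
      by_contra hqs
      push Not at hqs
      have hq0 : q i = 0 := le_antisymm hqs.1 (h i).2.1
      have hs0 : s i = 0 := le_antisymm hqs.2 (h i).2.2.1
      rw [hψ, hN, hq0, hs0] at hi
      simp at hi
    intro t ht
    have hNi : 0 < N i t := by
      rw [hN]
      rcases hqs with h1 | h1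
      · exact add_pos_of_pos_of_nonneg (by positivity) (mul_nonneg (mul_nonneg hc'.le (h i).2.2.1) (pow_pos ht c).le)
      · exact add_pos_of_nonneg_of_pos (mul_nonneg (mul_nonneg ha'.le (h i).2.1) (pow_pos ht a).le) (by positivity)
    have hψi : 0 < ψ i t := by rw [hψ]; exact div_pos hNi (hPpos i t ht)
    rw [hψB]
    exact lt_of_lt_of_le hψi (single_le_sum (f := fun j => ψ j t) (fun j _ => hψnn j t ht) (mem_univ i))
  -- the derivative of `F` on `(0,∞)`
  have hFd : ∀ t, 0 < t → HasDerivAt F (g t * ψB t / (t * Bf t * G t) * J t) t := by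
    intro t ht
    have ht0 : t ≠ 0 := ht.ne'
    have hpowa : (a : ℝ) * t ^ (a - 1) = (a : ℝ) * t ^ a / t := by
      rw [eq_div_iff ht0, mul_assoc, ← pow_succ, Nat.sub_add_cancel (show 1 ≤ a from ha)]
    have hpowc : (c : ℝ) * t ^ (c - 1) = (c : ℝ) * t ^ c / t := by
      rw [eq_div_iff ht0, mul_assoc, ← pow_succ, Nat.sub_add_cancel (show 1 ≤ c from hc)]
    have hrow : ∀ u v w : ℝ, HasDerivAt (fun x => u + v * x ^ a + w * x ^ c)
        (((a : ℝ) * v * t ^ a + (c : ℝ) * w * t ^ c) / t) t := by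
      intro u v w
      refine ((((hasDerivAt_pow a t).const_mul v).const_add u).fun_add
        ((hasDerivAt_pow c t).const_mul w)).congr_deriv ?_
      have e1 : v * ((a : ℝ) * t ^ (a - 1)) = (a : ℝ) * v * t ^ a / t := by rw [hpowa]; ring
      have e2 : w * ((c : ℝ) * t ^ (c - 1)) = (c : ℝ) * w * t ^ c / t := by rw [hpowc]; ring
      rw [e1, e2]; ring
    have hrow0 : ∀ v w : ℝ, HasDerivAt (fun x => v * x ^ a + w * x ^ c)
        (((a : ℝ) * v * t ^ a + (c : ℝ) * w * t ^ c) / t) t := by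
      intro v w
      refine (((hasDerivAt_pow a t).const_mul v).fun_add ((hasDerivAt_pow c t).const_mul w)).congr_deriv ?_
      have e1 : v * ((a : ℝ) * t ^ (a - 1)) = (a : ℝ) * v * t ^ a / t := by rw [hpowa]; ring
      have e2 : w * ((c : ℝ) * t ^ (c - 1)) = (c : ℝ) * w * t ^ c / t := by rw [hpowc]; ring
      rw [e1, e2]; ring
    have hPd : ∀ i, HasDerivAt (P i) (N i t / t) t := by
      intro i
      refine ((hrow (p i) (q i) (s i)).congr_of_eventuallyEq (Filter.Eventually.of_forall (hP i))).congr_deriv ?_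
      rw [hN]
    have hNd : ∀ i, HasDerivAt (N i) (M i t / t) t := by
      intro i
      refine ((hrow0 ((a : ℝ) * q i) ((c : ℝ) * s i)).congr_of_eventuallyEq
        (Filter.Eventually.of_forall (hN i))).congr_deriv ?_
      rw [hM]; ring
    have hψd : ∀ i, HasDerivAt (ψ i) ((M i t / P i t - ψ i t ^ 2) / t) t := by
      intro i
      have h1 := (hNd i).fun_div (hPd i) (hPpos i t ht).ne'
      refine (h1.congr_of_eventuallyEq (Filter.Eventually.of_forall (hψ i))).congr_deriv ?_
      have hP0 : P i t ≠ 0 := (hPpos i t ht).ne'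
      rw [hψ]
      field_simp
    have hψBd : HasDerivAt ψB (V t / t) t := by
      have h1 : HasDerivAt (fun x => ∑ i, ψ i x) (∑ i, (M i t / P i t - ψ i t ^ 2) / t) t :=
        HasDerivAt.fun_sum (u := univ) (fun i _ => hψd i)
      refine (h1.congr_of_eventuallyEq (Filter.Eventually.of_forall hψB)).congr_deriv ?_
      rw [hV, sum_div]
    have hgd : HasDerivAt g (G t / t) t := by
      refine ((hrow (-α) κ γ).congr_of_eventuallyEq (Filter.Eventually.of_forall hg)).congr_deriv ?_
      rw [hG]
    have hGd : HasDerivAt G (G₂ t / t) t := by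
      refine ((hrow0 ((a : ℝ) * κ) ((c : ℝ) * γ)).congr_of_eventuallyEq
        (Filter.Eventually.of_forall hG)).congr_deriv ?_
      rw [hG₂]; ring
    have hBfd : HasDerivAt Bf (Bf t * (ψB t / t)) t :=
      ((B.hasDerivAt t).congr_of_eventuallyEq (Filter.Eventually.of_forall fun x => (hBev x).symm)).congr_deriv
        (hBder t ht)
    -- assemble
    have h1 := (hgd.fun_mul hψBd).fun_div hGd (hGpos t ht).ne'
    have h2 := (h1.const_add 1).fun_div hBfd (hBpos t ht).ne'
    refine (h2.congr_of_eventuallyEq (Filter.Eventually.of_forall hF)).congr_deriv ?_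
    have hB0 : Bf t ≠ 0 := (hBpos t ht).ne'
    have hG0 : G t ≠ 0 := (hGpos t ht).ne'
    have hS0 : ψB t ≠ 0 := (hψBpos t ht).ne'
    rw [hJ]
    field_simp
    ring
  -- Rolle
  obtain ⟨-, -, hFu⟩ := hcrit u hu hDu
  obtain ⟨hgv, -, hFv⟩ := hcrit v (hu.trans huv) hDv
  have hcont : ContinuousOn F (Icc u v) := fun w hw =>
    (hFd w (hu.trans_le hw.1)).continuousAt.continuousWithinAt
  obtain ⟨ξ, hξ, hξ0⟩ := exists_hasDerivAt_eq_zero huv hcont (hFu.trans hFv.symm)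
    (fun w hw => hFd w (hu.trans hw.1))
  have hξpos : 0 < ξ := hu.trans hξ.1
  have hgξ : g ξ < 0 := (hgmono ξ v hξpos.le hξ.2.le).trans_lt hgv
  have hne : g ξ * ψB ξ / (ξ * Bf ξ * G ξ) ≠ 0 := by
    apply div_ne_zero
    · exact mul_ne_zero hgξ.ne (hψBpos ξ hξpos).ne'
    · exact mul_ne_zero (mul_ne_zero hξpos.ne' (hBpos ξ hξpos).ne') (hGpos ξ hξpos).ne'
  refine ⟨ξ, hξ.1, hξ.2, ?_⟩
  rcases mul_eq_zero.1 hξ0 with h1 | h1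
  · exact absurd h1 hne
  · exact h1

/-- **≤ 1 form**: if the rate function `J` has NO zero on `(0,∞)`, the product has at most ONE positive critical point. -/
theorem posCrit_le_one_of_rateJ_ne_zero (k a c : ℕ) (ha : 0 < a) (hac : a < c) (α κ γ : ℝ) (p q s : Fin k → ℝ)
    (hκ : 0 ≤ κ) (hγ : 0 < γ) (h : ∀ i, 0 ≤ p i ∧ 0 ≤ q i ∧ 0 ≤ s i ∧ 0 < p i + q i + s i)
    (hJ : ∀ ξ : ℝ, 0 < ξ →
      (∑ i, (((a : ℝ) ^ 2 * q i * ξ ^ a + (c : ℝ) ^ 2 * s i * ξ ^ c) / (p i + q i * ξ ^ a + s i * ξ ^ c)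
          - (((a : ℝ) * q i * ξ ^ a + (c : ℝ) * s i * ξ ^ c) / (p i + q i * ξ ^ a + s i * ξ ^ c)) ^ 2)) /
        (∑ i, ((a : ℝ) * q i * ξ ^ a + (c : ℝ) * s i * ξ ^ c) / (p i + q i * ξ ^ a + s i * ξ ^ c))
      - (∑ i, ((a : ℝ) * q i * ξ ^ a + (c : ℝ) * s i * ξ ^ c) / (p i + q i * ξ ^ a + s i * ξ ^ c))
      - ((a : ℝ) ^ 2 * κ * ξ ^ a + (c : ℝ) ^ 2 * γ * ξ ^ c) / ((a : ℝ) * κ * ξ ^ a + (c : ℝ) * γ * ξ ^ c) ≠ 0) :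
    posCrit (row a c (-α) κ γ * ∏ i, row a c (p i) (q i) (s i)) ≤ 1 := by
  classical
  rw [posCrit]
  by_contra hcard
  rw [not_le] at hcard
  obtain ⟨x, hx, y, hy, hxy⟩ := Finset.one_lt_card.1 hcard
  simp only [Finset.mem_filter, Multiset.mem_toFinset, mem_roots', IsRoot.def] at hx hy
  obtain ⟨⟨-, hDx⟩, hx0⟩ := hx
  obtain ⟨⟨-, hDy⟩, hy0⟩ := hy
  have key : ∀ u v, 0 < u → u < v →
      (derivative (row a c (-α) κ γ * ∏ i, row a c (p i) (q i) (s i))).eval u = 0 →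
      (derivative (row a c (-α) κ γ * ∏ i, row a c (p i) (q i) (s i))).eval v = 0 → False := by
    intro u v hu huv hDu hDv
    obtain ⟨ξ, h1, -, h3⟩ := exists_rateJ_zero_between_crit k a c ha hac α κ γ p q s hκ hγ h hu huv hDu hDv
    exact hJ ξ (hu.trans h1) h3
  rcases lt_or_gt_of_ne hxy with hxy | hxy
  · exact key x y hx0 hxy hDx hDy
  · exact key y x hy0 hxy hDy hDx

/-- **≤ 2 form**: if the rate function `J` vanishes AT MOST ONCE on `(0,∞)`, the product has at most TWO positive critical points. -/
theorem posCrit_le_two_of_rateJ_zero_once (k a c : ℕ) (ha : 0 < a) (hac : a < c) (α κ γ : ℝ) (p q s : Fin k → ℝ)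
    (hκ : 0 ≤ κ) (hγ : 0 < γ) (h : ∀ i, 0 ≤ p i ∧ 0 ≤ q i ∧ 0 ≤ s i ∧ 0 < p i + q i + s i)
    (hJ : ∀ ξ ξ' : ℝ, 0 < ξ → ξ < ξ' →
      (∑ i, (((a : ℝ) ^ 2 * q i * ξ ^ a + (c : ℝ) ^ 2 * s i * ξ ^ c) / (p i + q i * ξ ^ a + s i * ξ ^ c)
          - (((a : ℝ) * q i * ξ ^ a + (c : ℝ) * s i * ξ ^ c) / (p i + q i * ξ ^ a + s i * ξ ^ c)) ^ 2)) /
        (∑ i, ((a : ℝ) * q i * ξ ^ a + (c : ℝ) * s i * ξ ^ c) / (p i + q i * ξ ^ a + s i * ξ ^ c))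
      - (∑ i, ((a : ℝ) * q i * ξ ^ a + (c : ℝ) * s i * ξ ^ c) / (p i + q i * ξ ^ a + s i * ξ ^ c))
      - ((a : ℝ) ^ 2 * κ * ξ ^ a + (c : ℝ) ^ 2 * γ * ξ ^ c) / ((a : ℝ) * κ * ξ ^ a + (c : ℝ) * γ * ξ ^ c) = 0 →
      (∑ i, (((a : ℝ) ^ 2 * q i * ξ' ^ a + (c : ℝ) ^ 2 * s i * ξ' ^ c) / (p i + q i * ξ' ^ a + s i * ξ' ^ c)
          - (((a : ℝ) * q i * ξ' ^ a + (c : ℝ) * s i * ξ' ^ c) / (p i + q i * ξ' ^ a + s i * ξ' ^ c)) ^ 2)) /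
        (∑ i, ((a : ℝ) * q i * ξ' ^ a + (c : ℝ) * s i * ξ' ^ c) / (p i + q i * ξ' ^ a + s i * ξ' ^ c))
      - (∑ i, ((a : ℝ) * q i * ξ' ^ a + (c : ℝ) * s i * ξ' ^ c) / (p i + q i * ξ' ^ a + s i * ξ' ^ c))
      - ((a : ℝ) ^ 2 * κ * ξ' ^ a + (c : ℝ) ^ 2 * γ * ξ' ^ c) / ((a : ℝ) * κ * ξ' ^ a + (c : ℝ) * γ * ξ' ^ c) ≠ 0) :
    posCrit (row a c (-α) κ γ * ∏ i, row a c (p i) (q i) (s i)) ≤ 2 := by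
  classical
  rw [posCrit]
  by_contra hcard
  rw [not_le] at hcard
  obtain ⟨x, hx, y, hy, z, hz, hxy, hxz, hyz⟩ := Finset.two_lt_card.1 hcard
  simp only [Finset.mem_filter, Multiset.mem_toFinset, mem_roots', IsRoot.def] at hx hy hz
  obtain ⟨⟨-, hDx⟩, hx0⟩ := hx
  obtain ⟨⟨-, hDy⟩, hy0⟩ := hy
  obtain ⟨⟨-, hDz⟩, hz0⟩ := hz
  have key : ∀ t₁ t₂ t₃, 0 < t₁ → t₁ < t₂ → t₂ < t₃ →
      (derivative (row a c (-α) κ γ * ∏ i, row a c (p i) (q i) (s i))).eval t₁ = 0 →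
      (derivative (row a c (-α) κ γ * ∏ i, row a c (p i) (q i) (s i))).eval t₂ = 0 →
      (derivative (row a c (-α) κ γ * ∏ i, row a c (p i) (q i) (s i))).eval t₃ = 0 → False := by
    intro t₁ t₂ t₃ h1 h12 h23 hD1 hD2 hD3
    obtain ⟨ξ₁, h1ξ, hξ2, hJ₁⟩ := exists_rateJ_zero_between_crit k a c ha hac α κ γ p q s hκ hγ h h1 h12 hD1 hD2
    obtain ⟨ξ₂, h2ξ, -, hJ₂⟩ :=
      exists_rateJ_zero_between_crit k a c ha hac α κ γ p q s hκ hγ h (h1.trans h12) h23 hD2 hD3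
    exact hJ ξ₁ ξ₂ (h1.trans h1ξ) (hξ2.trans h2ξ) hJ₁ hJ₂
  rcases lt_or_gt_of_ne hxy with hxy | hxy <;> rcases lt_or_gt_of_ne hyz with hyz | hyz <;>
    rcases lt_or_gt_of_ne hxz with hxz | hxz
  · exact key x y z hx0 hxy hyz hDx hDy hDz
  · exact absurd (hxy.trans hyz) (lt_asymm hxz)
  · exact key x z y hx0 hxz hyz hDx hDz hDy
  · exact key z x y hz0 hxz hxy hDz hDx hDy
  · exact key y x z hy0 hxy hxz hDy hDx hDz
  · exact key y z x hy0 hyz hxz hDy hDz hDx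
  · exact absurd (hxz.trans hyz) (lt_asymm hxy)
  · exact key z y x hz0 hyz hxy hDz hDy hDx

end ZeroChange

end Summit.ValiantsHypothesis.ValiantsHypothesis.Theorems.LacunarySymmetroidMatrixDescartes
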